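import Literature.NumberTheory.Automorphic.ArchWhittakerTranslate
import Literature.NumberTheory.Automorphic.WhittakerUniquenessReduction
import Literature.NumberTheory.Automorphic.WhittakerSupportFinite
import Literature.NumberTheory.Automorphic.NormOneTorusAdelicCompact
import HarnessLib

/-!
# The archimedean bridge: finiteness of the unit-box Rankin–Selberg first moment from the
# archimedean local convergence

Topic `NumberTheory/Automorphic`; namespace `Literature.NumberTheory.Automorphic`. The step of the
printed proof of the pole of `L^S(s, π × π̃)` at `s = 1` (Jacquet–Shalika (1981), §4–§5;
Arthur–Clozel (1989), Ch. 3 (2.3)) in which the global unfolded integral is reduced to the LOCAL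
ARCHIMEDEAN integral: for a cuspidal automorphic representation `Π` of `GL_n(𝔸_K)`, `f ∈ Π`, a test
function `η` left invariant under a principal congruence subgroup `K(𝔫)`, and the Whittaker
coefficient `W = W_{S_η f}`, the part of the unfolded Rankin–Selberg integral at `s = 1` over the
box `𝕌_Kⁿ × K` (unit ideles in every coordinate — all finite places integral units) is finite,
PROVIDED the archimedean Rankin–Selberg integrals `Ψ_∞(1; W_∞, W̄_∞, Φ_∞)` of the archimedean
component `π_∞` of `Π` converge absolutely (`archRankinSelbergLIntegral … < ∞` of
`ArchRankinSelbergConvergence`, assumed for all irreducible unitary representations of `GL_n(K_∞)` —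
Jacquet–Shalika's archimedean theorem, taken as the spelled-out HYPOTHESIS `hX`, not vendored).

The argument ("`W` is a finite sum of pure tensors `W_∞ ⊗ W_f` with `W_f` taking finitely many
values on `GL_n(𝒪̂)`"), made honest in the `L²`-language of the tree:
* `exists_archComponent_decomposition`: the level piece `Π^{K_f(𝔫)}` is a finite orthogonal sum of
  copies `S_1, …, S_k` of the archimedean component `τ = π_∞`, and a level-`K_f(𝔫)` Gårding vector
  `v` has `ℓ(v) = Σ_i Φ_ℓ(S_i)(S_i† v)` for the global Whittaker functional `ℓ`
  (`apply_eq_sum_transferMap`), the transfers `Φ_ℓ(S_i)` being continuous `ψ_∞`-Whittaker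
  functionals on `τ` (`transferMap_mem_archContWhittakerFunctionals`);
* for `g = diag(a) k` with `a ∈ 𝕌_Kⁿ`, `g = (g_∞, 1)(1, κ)` with `κ ∈ GL_n(𝒪̂)`, and `κ = c u₀` with `c`
  one of the finitely many representatives of `GL_n(𝒪̂)/K_f(𝔫)` (`K_f(𝔫)` open in the compact
  `GL_n(𝒪̂)`); `R((1,u₀))` fixes `u = R(η) f`, so
  `W(g) = ℓ(R(g) u) = Σ_i Φ_ℓ(S_i)(τ(g_∞) S_i† R((1,c)) u)` (`adjoint_apply_archRegular`);
* hence `|W(diag(a) k)|² ≤ k · Σ_{i,c} |Φ_ℓ(S_i)(τ((diag(a) k)_∞) e_{i,c})|²`, and on `𝕌_Kⁿ × K` the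
  test function and the torus weight are their archimedean factors
  (`standardTestFun_lastRow_torusPoint_eq`, `torusWeight_eq_archTorusWeight`);
* the change of variables `(a, k) ↦ (a_∞, k_∞)` carries the Haar measures to Haar measures
  (`setLIntegral_unitBox_univ_prod_eq_lintegral_map`, `isHaarMeasure_map_archTorusOfIdele`,
  `isHaarMeasure_map_kinfOfMaximalCompact`), and each of the finitely many resulting integrals is
  an instance of the hypothesis `hX`.

## Main statements

* `whittakerCoeff_smoothedForm_eq_sum_transferMap`: `W_{S_η f}(g) = Σ_i Φ_ℓ(S_i)(τ(g_∞) e_i)`.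
* `continuous_transferMap_toArch`: `h ↦ Φ_ℓ(T)(τ(h) e)` is continuous on `GL_n(K_∞)`.
* `setLIntegral_unitBox_univ_torusIntegrand_lt_top`: the bridge.

## References

* H. Jacquet, J. A. Shalika, *On Euler products and the classification of automorphic
  representations I*, Amer. J. Math. 103 (1981), §4–§5 [JacquetShalikaAJM1981].
* J. Arthur, L. Clozel, *Simple algebras, base change, and the advanced theory of the trace
  formula* (1989), Ch. 3, (2.3) [ArthurClozelAMS120].
* J. W. Cogdell, *Analytic theory of L-functions for GL_n* (2004), §1.2, §4.2 [CogdellAnalyticTheory2004].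
-/

noncomputable section

open MeasureTheory Measure NumberField NumberField.mixedEmbedding IsDedekindDomain Set Filter
open Literature.NumberTheory.GaloisRepresentations (ideleGroup unitIdeles mem_unitIdeles_iff)
open scoped MatrixGroups ENNReal NNReal Classical

namespace Literature.NumberTheory.Automorphic

/-! ### Group-theoretic preliminaries -/

section Algebra

variable {n : ℕ} {K : Type} [Field K] [NumberField K]

/-- **`(1,u) g = g (1, κ⁻¹ u κ)`** for `g = (g_∞, κ)`: the finite part conjugates past `g`
(`G_∞` and `G(𝔸_f)` commute). [folklore] -/
theorem GLn.ofFinite_mul_eq_mul_ofFinite_conj (g : GL (Fin n) (AdeleRing (𝓞 K) K))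
    (u : GL (Fin n) (FiniteAdeleRing (𝓞 K) K)) :
    GLn.ofFinite n K u * g =
      g * GLn.ofFinite n K ((GLn.sndHom n K g)⁻¹ * u * GLn.sndHom n K g) := by
  have hg := GLn.ofInfinite_toMixed_mul_ofFinite_sndHom (n := n) (K := K) g
  have h1 : GLn.ofFinite n K u * g =
      GLn.ofInfinite n K (GLn.toMixed n K g) * GLn.ofFinite n K (u * GLn.sndHom n K g) := by
    conv_lhs => rw [← hg]
    rw [← mul_assoc, ← (GLn.commute_ofInfinite_ofFinite (GLn.toMixed n K g) u).eq, mul_assoc,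
      ← map_mul]
  have h3 : GLn.sndHom n K g * ((GLn.sndHom n K g)⁻¹ * u * GLn.sndHom n K g) =
      u * GLn.sndHom n K g := by group
  have h2 : g * GLn.ofFinite n K ((GLn.sndHom n K g)⁻¹ * u * GLn.sndHom n K g) =
      GLn.ofInfinite n K (GLn.toMixed n K g) * GLn.ofFinite n K (u * GLn.sndHom n K g) := by
    calc g * GLn.ofFinite n K ((GLn.sndHom n K g)⁻¹ * u * GLn.sndHom n K g)
        = GLn.ofInfinite n K (GLn.toMixed n K g) * GLn.ofFinite n K (GLn.sndHom n K g) *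
            GLn.ofFinite n K ((GLn.sndHom n K g)⁻¹ * u * GLn.sndHom n K g) := by rw [hg]
      _ = GLn.ofInfinite n K (GLn.toMixed n K g) * GLn.ofFinite n K (u * GLn.sndHom n K g) := by
          rw [mul_assoc, ← map_mul, h3]
  exact h1.trans h2.symm

/-- **Left `K_f(𝔫)`-invariance survives left translation by `g⁻¹` when `g_f ∈ GL_n(𝒪̂)`**
(`K_f(𝔫)` is normal in `GL_n(𝒪̂)`, `inv_mul_mul_mem_principalCongruenceLevel`). [folklore] -/
theorem translate_left_invariant_of_sndHom_mem {𝔫 : Ideal (𝓞 K)}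
    {η : GL (Fin n) (AdeleRing (𝓞 K) K) → ℝ}
    (hleft : ∀ u ∈ finitePrincipalCongruenceLevel n K 𝔫, ∀ x : GL (Fin n) (AdeleRing (𝓞 K) K),
      η (GLn.ofFinite n K u * x) = η x)
    {g : GL (Fin n) (AdeleRing (𝓞 K) K)} (hg : GLn.sndHom n K g ∈ glFiniteIntegralLevel n K) :
    ∀ u ∈ finitePrincipalCongruenceLevel n K 𝔫, ∀ x : GL (Fin n) (AdeleRing (𝓞 K) K),
      η (g⁻¹ * (GLn.ofFinite n K u * x)) = η (g⁻¹ * x) := by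
  intro u hu x
  have hconj : (GLn.sndHom n K g)⁻¹ * u * GLn.sndHom n K g ∈ finitePrincipalCongruenceLevel n K 𝔫 := by
    rw [mem_finitePrincipalCongruenceLevel_iff, map_mul, map_mul, map_inv]
    exact inv_mul_mul_mem_principalCongruenceLevel ((mem_finitePrincipalCongruenceLevel_iff).1 hu) hg
  have hUg := GLn.ofFinite_mul_eq_mul_ofFinite_conj g u
  have key : g⁻¹ * GLn.ofFinite n K u =
      GLn.ofFinite n K ((GLn.sndHom n K g)⁻¹ * u * GLn.sndHom n K g) * g⁻¹ := by
    rw [inv_mul_eq_iff_eq_mul, ← mul_assoc, ← hUg, mul_inv_cancel_right]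
  rw [← mul_assoc, key, mul_assoc, hleft _ hconj]

omit [NumberField K] in
/-- The last row map `archLastRow` is continuous. [folklore] -/
theorem continuous_archLastRow : Continuous (archLastRow n K) := by
  unfold archLastRow
  refine continuous_pi fun j => (continuous_ringEquiv_mixedSpace_symm K).comp ?_
  exact (continuous_apply j).comp (continuous_const.matrix_vecMul Units.continuous_val)

/-- The archimedean torus weight is continuous on `(K_∞ˣ)ⁿ`. [folklore] -/
theorem continuous_archTorusWeight (σ : ℝ) : Continuous (archTorusWeight n K σ) := by
  unfold archTorusWeight
  refine continuous_finsetProd _ fun i _ => ?_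
  exact ((mixedEmbedding.continuous_norm K).comp
    (Units.continuous_val.comp (continuous_apply i))).rpow_const
      fun y => Or.inl (norm_ne_zero_of_isUnit K (y i).isUnit)

end Algebra

/-! ### The Whittaker coefficient as a finite sum of archimedean matrix coefficients -/

section Decomposition

variable {n : ℕ} {K : Type} [Field K] [NumberField K]
  {μ : Measure (AdelicGroupData.gl n K).automorphicQuotient} [(AdelicGroupData.gl n K).IsAutomorphicMeasure μ]

attribute [local instance] adelicBorel borelSpace_adelic locallyCompactSpace_adelic secondCountableTopology_gl_adelic
  glAdeleBorel borelSpace_glAdele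

/-- **`h ↦ Φ_ℓ(T)(τ(h) e)` is continuous on `GL_n(K_∞)`**: it is `h ↦ ℓ(R((h,1)) T̂ e)`
(`corestrictW_apply_apply`), continuous by `continuous_whittakerFunctional_toContRep`. [folklore] -/
theorem continuous_transferMap_toArch (hcpt : isCompact_glFiniteIntegralLevel n K)
    {W : ContRepresentation.ClosedSubrep ((AdelicGroupData.gl n K).rightRegular μ)}
    {E : Type*} [NormedAddCommGroup E] [InnerProductSpace ℂ E] [CompleteSpace E]
    {τ : ContRepresentation ℂ (AutomorphyDatum.gl n K hcpt).arch.carrier E}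
    (hτc : τ.IsStronglyContinuous)
    {U₀ : Subgroup (GL (Fin n) (FiniteAdeleRing (𝓞 K) K))}
    (hU₀o : IsOpen (U₀ : Set (GL (Fin n) (FiniteAdeleRing (𝓞 K) K))))
    (hU₀c : IsCompact (U₀ : Set (GL (Fin n) (FiniteAdeleRing (𝓞 K) K))))
    {T : E →L[ℂ] (AdelicGroupData.gl n K).L2 μ} (hT : T ∈ archIntertwinersLevel hcpt τ W U₀)
    (ν₀ : Measure ↥(adelicUnipotent n K)) [IsFiniteMeasureOnCompacts ν₀]
    {ψ : AddChar (AdeleRing (𝓞 K) K) Circle} (hψ : Continuous ψ) (e : archGardingSpace hcpt τ) :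
    Continuous fun h : GL (Fin n) (mixedSpace K) =>
      transferMap (whittakerFunctional ν₀ hψ (ContRepresentation.Equiv.refl W.toContRep)) hτc
        ⟨T, mem_multiplicityModule_of_mem_archIntertwinersLevel hU₀o hU₀c hT⟩
        ⟨τ (toArch hcpt h) (e : E), apply_mem_archGardingSpace hτc _ e.2⟩ := by
  have hx : corestrictW hT.1 (e : E) ∈ gardingSpace W :=
    gardingSubspace_le_gardingSpace U₀ (corestrictW_mem_gardingSubspace hT hτc hU₀o hU₀c e.2)
  have heq : (fun h : GL (Fin n) (mixedSpace K) =>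
      transferMap (whittakerFunctional ν₀ hψ (ContRepresentation.Equiv.refl W.toContRep)) hτc
        ⟨T, mem_multiplicityModule_of_mem_archIntertwinersLevel hU₀o hU₀c hT⟩
        ⟨τ (toArch hcpt h) (e : E), apply_mem_archGardingSpace hτc _ e.2⟩) =
      fun h => whittakerFunctional ν₀ hψ (ContRepresentation.Equiv.refl W.toContRep)
        ⟨W.toContRep (GLn.ofInfinite n K h) (corestrictW hT.1 (e : E)),
          toContRep_mem_gardingSpace _ hx⟩ := by
    funext h
    rw [transferMap_apply_apply]
    congr 1
    exact Subtype.ext (corestrictW_apply_apply hT.1 h (e : E))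
  rw [heq]
  exact (continuous_whittakerFunctional_toContRep ν₀ hψ hx).comp (GLn.continuous_ofInfinite n K)

/-- **`W_{S_η f}(g) = Σ_i Φ_ℓ(S_i)(τ(g_∞) e_i)`, `e_i = S_i† R((1,c)) R(η) f`**, for `g = (g_∞, c u₀)`
with `u₀` in the level `U₀` of `η`: the global Whittaker coefficient of a smoothed cusp form is a
finite sum of archimedean Whittaker functions of the archimedean component `τ`
(`apply_eq_sum_transferMap`, `adjoint_apply_archRegular`). [cite: CogdellAnalyticTheory2004, §1.2] -/
theorem whittakerCoeff_smoothedForm_eq_sum_transferMap (hcpt : isCompact_glFiniteIntegralLevel n K)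
    (P : CuspidalAutomorphicRepGL n K μ)
    {E : Type*} [NormedAddCommGroup E] [InnerProductSpace ℂ E] [CompleteSpace E]
    {τ : ContRepresentation ℂ (AutomorphyDatum.gl n K hcpt).arch.carrier E}
    (hτu : τ.IsUnitary) (hτi : τ.IsTopIrreducible) (hτc : τ.IsStronglyContinuous)
    (hex : ∃ T ∈ archIntertwiners hcpt τ P.1, T ≠ 0)
    {U₀ : Subgroup (GL (Fin n) (FiniteAdeleRing (𝓞 K) K))}
    (hU₀o : IsOpen (U₀ : Set (GL (Fin n) (FiniteAdeleRing (𝓞 K) K))))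
    (hU₀c : IsCompact (U₀ : Set (GL (Fin n) (FiniteAdeleRing (𝓞 K) K))))
    {k : ℕ} {S : Fin k → E →L[ℂ] (AdelicGroupData.gl n K).L2 μ}
    (hS : ∀ i, S i ∈ archIntertwinersLevel hcpt τ P.1 U₀)
    (hSon : ∀ i j, schurCoeff (μ := μ) (S i) (S j) = if i = j then 1 else 0)
    (hspan : ∀ T ∈ archIntertwinersLevel hcpt τ P.1 U₀, T ∈ Submodule.span ℂ (Set.range S))
    (ν₀ : Measure ↥(adelicUnipotent n K)) [IsHaarMeasure ν₀]
    {η : GL (Fin n) (AdeleRing (𝓞 K) K) → ℝ} (hη : IsTestFunctionGL n K η) (f : P.1.toSubmodule)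
    {g : GL (Fin n) (AdeleRing (𝓞 K) K)} {c u₀ : GL (Fin n) (FiniteAdeleRing (𝓞 K) K)}
    (hu₀ : u₀ ∈ U₀) (hg : GLn.sndHom n K g = c * u₀)
    (hleft : ∀ u ∈ U₀, ∀ x : GL (Fin n) (AdeleRing (𝓞 K) K), η (GLn.ofFinite n K u * x) = η x)
    (hleftg : ∀ u ∈ U₀, ∀ x : GL (Fin n) (AdeleRing (𝓞 K) K),
      η (g⁻¹ * (GLn.ofFinite n K u * x)) = η (g⁻¹ * x))
    (e : Fin k → archGardingSpace hcpt τ)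
    (he : ∀ i, (e i : E) = ContinuousLinearMap.adjoint (S i)
      ((P.1.toContRep (GLn.ofFinite n K c) (smoothedVector P.1 η f) : P.1.toSubmodule) :
        (AdelicGroupData.gl n K).L2 μ)) :
    whittakerCoeff ν₀ (unipotentTateDomain n K) (adeleAddChar K)
        (invQuot (AdelicGroupData.gl n K) (smoothedForm η (f : (AdelicGroupData.gl n K).L2 μ))) g =
      ∑ i, transferMap (whittakerFunctional ν₀ (continuous_adeleAddChar K)
          (ContRepresentation.Equiv.refl P.1.toContRep)) hτc
          ⟨S i, mem_multiplicityModule_of_mem_archIntertwinersLevel hU₀o hU₀c (hS i)⟩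
          ⟨τ (toArch hcpt (GLn.toMixed n K g)) (e i : E), apply_mem_archGardingSpace hτc _ (e i).2⟩ := by
  set u : P.1.toSubmodule := smoothedVector P.1 η f with hu_def
  have hu : u ∈ gardingSpace P.1 := smoothedVector_mem_gardingSpace hη f
  have husub : u ∈ gardingSubspace P.1 U₀ := smoothedVector_mem_gardingSubspace hη hleft f
  have hvsub : P.1.toContRep g u ∈ gardingSubspace P.1 U₀ := by
    rw [hu_def, toContRep_smoothedVector_eq _ hη.continuous hη.hasCompactSupport g f]
    exact smoothedVector_mem_gardingSubspace (hη.comp_mul_left g⁻¹) hleftg f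
  rw [← whittakerFunctional_toContRep_eq_whittakerCoeff ν₀ (continuous_adeleAddChar K) hu
    (hasContRep_smoothedVector P.1 hη.continuous hη.hasCompactSupport f) g,
    apply_eq_sum_transferMap P hτu hτi hτc hex hU₀o hU₀c hS hSon hspan _ hvsub
      (toContRep_mem_gardingSpace g hu)]
  refine Finset.sum_congr rfl fun i _ => ?_
  congr 1
  apply Subtype.ext
  change ContinuousLinearMap.adjoint (S i)
      ((P.1.toContRep g u : P.1.toSubmodule) : (AdelicGroupData.gl n K).L2 μ) =
    τ (toArch hcpt (GLn.toMixed n K g)) (e i : E)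
  -- `R((1,u₀))` fixes `u`, so `R(g) u = R((g_∞,1)) R((1,c)) u`
  have hfix : P.1.toContRep (GLn.ofFinite n K u₀) u = u := by
    apply Subtype.ext
    rw [ContRepresentation.ClosedSubrep.coe_toContRep_apply]
    exact ((mem_levelPiece_iff (hcpt := hcpt)).1
      (coe_mem_levelPiece_of_mem_gardingSubspace husub)).2 u₀ hu₀
  have hmul : ∀ (a b : GL (Fin n) (AdeleRing (𝓞 K) K)) (x : P.1.toSubmodule),
      P.1.toContRep (a * b) x = P.1.toContRep a (P.1.toContRep b x) := fun a b x =>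
    (DFunLike.congr_fun (map_mul P.1.toContRep a b) x).trans rfl
  have hgfac : g = GLn.ofInfinite n K (GLn.toMixed n K g) *
      (GLn.ofFinite n K c * GLn.ofFinite n K u₀) := by
    rw [← map_mul, ← hg, GLn.ofInfinite_toMixed_mul_ofFinite_sndHom]
  have hfac : P.1.toContRep g u =
      P.1.toContRep (GLn.ofInfinite n K (GLn.toMixed n K g)) (P.1.toContRep (GLn.ofFinite n K c) u) := by
    conv_lhs => rw [hgfac]
    rw [hmul, hmul, hfix]
  rw [hfac, ContRepresentation.ClosedSubrep.coe_toContRep_apply, ← archRegular_toArch_apply (hcpt := hcpt),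
    adjoint_apply_archRegular hτu (hS i).1, ← he i]

end Decomposition

/-! ### The bridge -/

section Bridge

variable {n : ℕ} {K : Type} [Field K] [NumberField K]
  {μ : Measure (AdelicGroupData.gl n K).automorphicQuotient} [(AdelicGroupData.gl n K).IsAutomorphicMeasure μ]

attribute [local instance] adelicBorel borelSpace_adelic locallyCompactSpace_adelic secondCountableTopology_gl_adelic
  glAdeleBorel borelSpace_glAdele

attribute [local instance] Literature.MeasureTheory.Group.hasSummableGeomSeries_of_finiteDimensional
  Literature.MeasureTheory.Group.Units.borelSpace_of_isOpenEmbedding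
  Literature.MeasureTheory.Group.Units.secondCountableTopology
  Literature.MeasureTheory.Group.Units.locallyCompactSpace

attribute [local instance] secondCountableTopology_ideleGroup borelSpace_pi_mixedUnits measurableMul_pi_mixedUnits

variable [MeasurableSpace (ideleGroup K)] [BorelSpace (ideleGroup K)]
  [MeasurableSpace (GL (Fin n) (mixedSpace K))] [BorelSpace (GL (Fin n) (mixedSpace K))]

/-- The elementary inequality `|Σ_i A_i|² B ≤ k Σ_i |A_i|² B` (`B ≥ 0`), in `[0, ∞]`. [folklore] -/
theorem ofReal_norm_sum_sq_mul_le {k : ℕ} (A : Fin k → ℂ) {B : ℝ} (hB : 0 ≤ B) :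
    ENNReal.ofReal (‖∑ i, A i‖ ^ 2 * B) ≤ (k : ℝ≥0∞) * ∑ i, ‖A i‖ₑ ^ 2 * ENNReal.ofReal B := by
  have h1 : ‖∑ i, A i‖ ^ 2 ≤ (k : ℝ) * ∑ i, ‖A i‖ ^ 2 := by
    calc ‖∑ i, A i‖ ^ 2 ≤ (∑ i, ‖A i‖) ^ 2 :=
          pow_le_pow_left₀ (norm_nonneg _) (norm_sum_le _ _) 2
      _ ≤ (Finset.univ.card : ℝ) * ∑ i, ‖A i‖ ^ 2 := sq_sum_le_card_mul_sum_sq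
      _ = (k : ℝ) * ∑ i, ‖A i‖ ^ 2 := by rw [Finset.card_univ, Fintype.card_fin]
  have hsum : 0 ≤ ∑ i, ‖A i‖ ^ 2 := Finset.sum_nonneg fun i _ => sq_nonneg _
  calc ENNReal.ofReal (‖∑ i, A i‖ ^ 2 * B)
      ≤ ENNReal.ofReal ((k : ℝ) * (∑ i, ‖A i‖ ^ 2) * B) :=
        ENNReal.ofReal_le_ofReal (mul_le_mul_of_nonneg_right h1 hB)
    _ = (k : ℝ≥0∞) * ∑ i, ‖A i‖ₑ ^ 2 * ENNReal.ofReal B := by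
        rw [ENNReal.ofReal_mul (mul_nonneg (Nat.cast_nonneg _) hsum),
          ENNReal.ofReal_mul (Nat.cast_nonneg _), ENNReal.ofReal_natCast,
          ENNReal.ofReal_sum_of_nonneg (fun i _ => sq_nonneg _), ← Finset.sum_mul, mul_assoc]
        congr 2
        refine Finset.sum_congr rfl fun i _ => ?_
        rw [ENNReal.ofReal_pow (norm_nonneg _), ofReal_norm]

/-- **The archimedean bridge.** Assume the archimedean Rankin–Selberg integrals of unitary generic
representations of `GL_n(K_∞)` converge absolutely at `s = 1` (hypothesis `hX`: for every irreducible
unitary strongly continuous `τ`, continuous `ψ_∞`-Whittaker functional `ℓ`, Gårding vector `e` and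
Haar measures, `archRankinSelbergLIntegral hcpt τ hτ ℓ e μA μK < ∞` — Jacquet–Shalika's archimedean
theorem, Cogdell (2004), §3.1 (1), §3.2, taken as a hypothesis). Then for a cuspidal automorphic
representation `Π`
of `GL_n(𝔸_K)`, `f ∈ Π`, a test function `η` left invariant under `(1, K_f(𝔫))` (`𝔫 ≠ 0`) and the
Whittaker coefficient `W = W_{S_η f}`, the unit-box part of the unfolded Rankin–Selberg integral of
`(W, W̄, Φ^{Gauss})` at `s = 1` is finite:
`∫⁻_{𝕌_Kⁿ × K} |W(diag(a) k)|² Φ(e_n diag(a) k) |det a| δ_B(a)⁻¹ d(νA × νK) < ∞`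
(Jacquet–Shalika (1981), §4: the global integral is a finite sum of products of local ones, the
archimedean ones converging for `Re s ≥ 1`). [cite: JacquetShalikaAJM1981, §4–§5]
[cite: ArthurClozelAMS120, Ch. 3 §2 (2.3)] -/
theorem setLIntegral_unitBox_univ_torusIntegrand_lt_top
    (hX : ∀ (hcpt : isCompact_glFiniteIntegralLevel n K) (E : Type) [NormedAddCommGroup E]
      [InnerProductSpace ℂ E] [CompleteSpace E]
      (τ : ContRepresentation ℂ (AutomorphyDatum.gl n K hcpt).arch.carrier E) (hτ : τ.IsStronglyContinuous)
      (_ : τ.IsUnitary) (_ : τ.IsTopIrreducible)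
      (ℓ : archGardingSpace hcpt τ →ₗ[ℂ] ℂ) (_ : IsArchContWhittakerFunctional hcpt τ hτ ℓ)
      (e : archGardingSpace hcpt τ)
      [MeasurableSpace (GL (Fin n) (mixedSpace K))] [BorelSpace (GL (Fin n) (mixedSpace K))]
      [MeasurableSpace ((mixedSpace K)ˣ)] [BorelSpace ((mixedSpace K)ˣ)]
      (μA : Measure (Fin n → (mixedSpace K)ˣ)) (_ : IsHaarMeasure μA)
      (μK : Measure ↥(Kinf n K)) (_ : IsHaarMeasure μK),
      archRankinSelbergLIntegral hcpt τ hτ ℓ e μA μK < ⊤)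
    (P : CuspidalAutomorphicRepGL n K μ) {𝔫 : Ideal (𝓞 K)} (h𝔫 : 𝔫 ≠ 0)
    {η : GL (Fin n) (AdeleRing (𝓞 K) K) → ℝ} (hη : IsTestFunctionGL n K η)
    (hleft : ∀ u ∈ finitePrincipalCongruenceLevel n K 𝔫, ∀ x : GL (Fin n) (AdeleRing (𝓞 K) K),
      η (GLn.ofFinite n K u * x) = η x)
    (f : P.1.toSubmodule)
    (νA : Measure (Fin n → ideleGroup K)) [IsHaarMeasure νA]
    (νK : Measure ↥(maximalCompactAdelic n K)) [IsHaarMeasure νK]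
    (ν₀ : Measure ↥(adelicUnipotent n K)) [IsHaarMeasure ν₀] :
    ∫⁻ p in unitBox (Set.univ : Set (HeightOneSpectrum (𝓞 K))) ×ˢ Set.univ,
        torusIntegrand n K
          (whittakerCoeff ν₀ (unipotentTateDomain n K) (adeleAddChar K)
            (invQuot (AdelicGroupData.gl n K) (smoothedForm η (f : (AdelicGroupData.gl n K).L2 μ))))
          (standardTestFun n K (gaussArchTestFun n K)) 1 p ∂(νA.prod νK) < ⊤ := by
  classical
  have hcpt : isCompact_glFiniteIntegralLevel n K := isCompact_glFiniteIntegralLevel_holds n K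
  set U₀ : Subgroup (GL (Fin n) (FiniteAdeleRing (𝓞 K) K)) := finitePrincipalCongruenceLevel n K 𝔫 with hU₀
  have hU₀o : IsOpen (U₀ : Set (GL (Fin n) (FiniteAdeleRing (𝓞 K) K))) :=
    isOpen_finitePrincipalCongruenceLevel n K h𝔫
  have hU₀c : IsCompact (U₀ : Set (GL (Fin n) (FiniteAdeleRing (𝓞 K) K))) :=
    isCompact_finitePrincipalCongruenceLevel n K h𝔫
  obtain ⟨E, _, _, _, τ, hτi, hτu, hτc, hex, hdec⟩ := exists_archComponent_decomposition (hcpt := hcpt) P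
  obtain ⟨k, S, hS, hSon, hspan, -⟩ := hdec U₀ hU₀o hU₀c
  -- the finitely many cosets `GL_n(𝒪̂) / K_f(𝔫)`
  haveI : CompactSpace ↥(glFiniteIntegralLevel n K) := isCompact_iff_compactSpace.1 hcpt
  set H : Subgroup ↥(glFiniteIntegralLevel n K) := U₀.subgroupOf (glFiniteIntegralLevel n K) with hH
  have hHo : IsOpen (H : Set ↥(glFiniteIntegralLevel n K)) := hU₀o.preimage continuous_subtype_val
  haveI : Finite (↥(glFiniteIntegralLevel n K) ⧸ H) := Subgroup.quotient_finite_of_isOpen H hHo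
  haveI : Fintype (↥(glFiniteIntegralLevel n K) ⧸ H) := Fintype.ofFinite _
  obtain ⟨rep, hrep⟩ : ∃ rep : ↥(glFiniteIntegralLevel n K) ⧸ H → GL (Fin n) (FiniteAdeleRing (𝓞 K) K),
      rep = fun q => ((Quotient.out q : ↥(glFiniteIntegralLevel n K)) : GL (Fin n) (FiniteAdeleRing (𝓞 K) K)) :=
    ⟨_, rfl⟩
  have hrep_mem : ∀ q, rep q ∈ glFiniteIntegralLevel n K := fun q => by
    rw [hrep]
    exact (Quotient.out q).2
  -- the vectors `e_{i,q} = S_i† R((1, c_q)) R(η) f`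
  set u : P.1.toSubmodule := smoothedVector P.1 η f with hu_def
  have hcsub : ∀ q, P.1.toContRep (GLn.ofFinite n K (rep q)) u ∈ gardingSubspace P.1 U₀ := fun q => by
    rw [hu_def, toContRep_smoothedVector_eq _ hη.continuous hη.hasCompactSupport]
    refine smoothedVector_mem_gardingSubspace (hη.comp_mul_left _) ?_ f
    have hg : GLn.sndHom n K (GLn.ofFinite n K (rep q)) ∈ glFiniteIntegralLevel n K := by
      rw [GLn.sndHom_ofFinite]
      exact hrep_mem q
    exact translate_left_invariant_of_sndHom_mem hleft hg
  obtain ⟨e, he_def⟩ : ∃ e : Fin k → (↥(glFiniteIntegralLevel n K) ⧸ H) → archGardingSpace hcpt τ,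
      e = fun i q => ⟨ContinuousLinearMap.adjoint (S i)
        ((P.1.toContRep (GLn.ofFinite n K (rep q)) u : P.1.toSubmodule) : (AdelicGroupData.gl n K).L2 μ),
        (eq_sum_apply_of_mem_gardingSubspace P hτu hτi hτc hex hS hSon hspan hU₀o hU₀c (hcsub q)).1 i⟩ :=
    ⟨_, rfl⟩
  have he : ∀ i q, (e i q : E) = ContinuousLinearMap.adjoint (S i)
      ((P.1.toContRep (GLn.ofFinite n K (rep q)) u : P.1.toSubmodule) : (AdelicGroupData.gl n K).L2 μ) :=
    fun i q => by rw [he_def]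
  -- the functionals `Φ_ℓ(S_i)`
  obtain ⟨ℓ, hℓ_def⟩ : ∃ ℓ : gardingSpace P.1 →ₗ[ℂ] ℂ,
      ℓ = whittakerFunctional ν₀ (continuous_adeleAddChar K) (ContRepresentation.Equiv.refl P.1.toContRep) :=
    ⟨_, rfl⟩
  have hℓ : IsContWhittakerFunctional P.1 (adeleAddChar K) ℓ := by
    rw [hℓ_def]
    exact isContWhittakerFunctional_whittakerFunctional ν₀ (continuous_adeleAddChar K)
      (isGlobalAddChar_adeleAddChar K) _
  obtain ⟨ℓi, hℓi_def⟩ : ∃ ℓi : Fin k → (archGardingSpace hcpt τ →ₗ[ℂ] ℂ), ℓi = fun i =>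
      transferMap ℓ hτc ⟨S i, mem_multiplicityModule_of_mem_archIntertwinersLevel hU₀o hU₀c (hS i)⟩ :=
    ⟨_, rfl⟩
  have hℓi : ∀ i, IsArchContWhittakerFunctional hcpt τ hτc (ℓi i) := fun i => by
    rw [hℓi_def]
    exact transferMap_mem_archContWhittakerFunctionals hℓ hτc _
  -- the archimedean integrands
  obtain ⟨A, hA_def⟩ : ∃ A : Fin k → (↥(glFiniteIntegralLevel n K) ⧸ H) → GL (Fin n) (mixedSpace K) → ℂ,
      A = fun i q h => ℓi i ⟨τ (toArch hcpt h) (e i q : E), apply_mem_archGardingSpace hτc _ (e i q).2⟩ :=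
    ⟨_, rfl⟩
  have hAc : ∀ i q, Continuous (A i q) := fun i q => by
    rw [hA_def, hℓi_def, hℓ_def]
    exact continuous_transferMap_toArch hcpt hτc hU₀o hU₀c (hS i) ν₀ (continuous_adeleAddChar K) (e i q)
  obtain ⟨F, hF_def⟩ : ∃ F : Fin k → (↥(glFiniteIntegralLevel n K) ⧸ H) →
      (Fin n → (mixedSpace K)ˣ) × ↥(Kinf n K) → ℝ≥0∞, F = fun i q z =>
      ‖A i q (glDiagonal n (mixedSpace K) z.1 * (z.2 : GL (Fin n) (mixedSpace K)))‖ₑ ^ 2 *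
        ENNReal.ofReal (gaussArchTestFun n K (archLastRow n K
          (glDiagonal n (mixedSpace K) z.1 * (z.2 : GL (Fin n) (mixedSpace K)))) * archTorusWeight n K 1 z.1) :=
    ⟨_, rfl⟩
  have hm : Continuous fun z : (Fin n → (mixedSpace K)ˣ) × ↥(Kinf n K) =>
      glDiagonal n (mixedSpace K) z.1 * (z.2 : GL (Fin n) (mixedSpace K)) :=
    ((continuous_glDiagonal (n := n) (mixedSpace K)).comp continuous_fst).mul
      (continuous_subtype_val.comp continuous_snd)
  have hFm : ∀ i q, Measurable (F i q) := fun i q => by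
    rw [hF_def]
    exact (((hAc i q).comp hm).measurable.enorm.pow_const 2).mul
      (ENNReal.measurable_ofReal.comp
        ((((continuous_gaussArchTestFun n K).comp (continuous_archLastRow.comp hm)).mul
          ((continuous_archTorusWeight 1).comp continuous_fst)).measurable))
  -- the image measures are Haar measures, and each archimedean integral is finite
  obtain ⟨μA, hμA⟩ : ∃ μA : Measure (Fin n → (mixedSpace K)ˣ),
      μA = (νA.restrict (unitBox (Set.univ : Set (HeightOneSpectrum (𝓞 K))))).map (archTorusOfIdele n K) :=
    ⟨_, rfl⟩
  obtain ⟨μK, hμK⟩ : ∃ μK : Measure ↥(Kinf n K), μK = νK.map (kinfOfMaximalCompact n K) := ⟨_, rfl⟩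
  haveI : IsHaarMeasure μA := by rw [hμA]; exact isHaarMeasure_map_archTorusOfIdele νA
  haveI : IsHaarMeasure μK := by rw [hμK]; exact isHaarMeasure_map_kinfOfMaximalCompact νK
  have hFfin : ∀ i q, ∫⁻ z, F i q z ∂(μA.prod μK) < ⊤ := fun i q => by
    rw [hF_def, hA_def]
    exact hX hcpt E τ hτc hτu hτi (ℓi i) (hℓi i) (e i q) μA inferInstance μK inferInstance
  -- pointwise bound on the box
  have hboxm : MeasurableSet (unitBox (n := n) (K := K) (Set.univ : Set (HeightOneSpectrum (𝓞 K))) ×ˢ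
      (Set.univ : Set ↥(maximalCompactAdelic n K))) :=
    (measurableSet_unitBox _).prod MeasurableSet.univ
  have hpt : ∀ p ∈ unitBox (n := n) (K := K) (Set.univ : Set (HeightOneSpectrum (𝓞 K))) ×ˢ
      (Set.univ : Set ↥(maximalCompactAdelic n K)),
      torusIntegrand n K
          (whittakerCoeff ν₀ (unipotentTateDomain n K) (adeleAddChar K)
            (invQuot (AdelicGroupData.gl n K) (smoothedForm η (f : (AdelicGroupData.gl n K).L2 μ))))
          (standardTestFun n K (gaussArchTestFun n K)) 1 p ≤
        (k : ℝ≥0∞) * ∑ i, ∑ q, F i q (archTorusOfIdele n K p.1, kinfOfMaximalCompact n K p.2) := by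
    rintro ⟨a, kk⟩ ⟨ha, -⟩
    have hκ : GLn.sndHom n K (torusPoint n K (a, kk)) ∈ glFiniteIntegralLevel n K :=
      sndHom_torusPoint_mem_glFiniteIntegralLevel ha kk
    set q : ↥(glFiniteIntegralLevel n K) ⧸ H := QuotientGroup.mk ⟨_, hκ⟩ with hq
    obtain ⟨h, hh⟩ := QuotientGroup.mk_out_eq_mul H ⟨_, hκ⟩
    have hu₀ : ((h : ↥(glFiniteIntegralLevel n K)) : GL (Fin n) (FiniteAdeleRing (𝓞 K) K))⁻¹ ∈ U₀ :=
      U₀.inv_mem (Subgroup.mem_subgroupOf.1 h.2)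
    have hgdec : GLn.sndHom n K (torusPoint n K (a, kk)) =
        rep q * ((h : ↥(glFiniteIntegralLevel n K)) : GL (Fin n) (FiniteAdeleRing (𝓞 K) K))⁻¹ := by
      rw [eq_mul_inv_iff_mul_eq, hrep]
      change _ = ((Quotient.out q : ↥(glFiniteIntegralLevel n K)) : GL (Fin n) (FiniteAdeleRing (𝓞 K) K))
      rw [hq, hh]
      rfl
    have hW := whittakerCoeff_smoothedForm_eq_sum_transferMap hcpt P hτu hτi hτc hex hU₀o hU₀c hS hSon
      hspan ν₀ hη f hu₀ hgdec hleft (translate_left_invariant_of_sndHom_mem hleft hκ) (fun i => e i q)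
      (fun i => he i q)
    simp only [torusIntegrand]
    rw [hW, standardTestFun_lastRow_torusPoint_eq _ ha, torusWeight_eq_archTorusWeight 1 ha,
      toMixed_torusPoint, mul_assoc]
    have hB : 0 ≤ gaussArchTestFun n K (archLastRow n K (glDiagonal n (mixedSpace K) (archTorusOfIdele n K a) *
        (kinfOfMaximalCompact n K kk : GL (Fin n) (mixedSpace K)))) *
        archTorusWeight n K 1 (archTorusOfIdele n K a) := by
      refine mul_nonneg (gaussArchTestFun_pos n K _).le ?_
      unfold archTorusWeight
      exact Finset.prod_nonneg fun i _ => Real.rpow_nonneg (mixedEmbedding.norm_nonneg _) _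
    refine (ofReal_norm_sum_sq_mul_le _ hB).trans ?_
    calc _ = (k : ℝ≥0∞) * ∑ i, F i q (archTorusOfIdele n K a, kinfOfMaximalCompact n K kk) := by
          simp only [hF_def, hA_def, hℓi_def, hℓ_def]
      _ ≤ (k : ℝ≥0∞) * ∑ i, ∑ q', F i q' (archTorusOfIdele n K a, kinfOfMaximalCompact n K kk) :=
          mul_le_mul' le_rfl (Finset.sum_le_sum fun i _ =>
            Finset.single_le_sum (f := fun q' => F i q' (archTorusOfIdele n K a, kinfOfMaximalCompact n K kk))
              (fun _ _ => zero_le) (Finset.mem_univ q))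
  -- integrate
  haveI := locallyCompactSpace_ideleGroup K
  haveI : CompactSpace ↥(maximalCompactAdelic n K) :=
    isCompact_iff_compactSpace.1 (isCompact_maximalCompactAdelic n K)
  haveI : SigmaFinite νA := inferInstance
  haveI : IsFiniteMeasure νK := inferInstance
  have hSm : Measurable fun z : (Fin n → (mixedSpace K)ˣ) × ↥(Kinf n K) => ∑ i, ∑ q, F i q z :=
    Finset.measurable_sum _ fun i _ => Finset.measurable_sum _ fun q _ => hFm i q
  have hGm : Measurable fun z : (Fin n → (mixedSpace K)ˣ) × ↥(Kinf n K) =>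
      (k : ℝ≥0∞) * ∑ i, ∑ q, F i q z := hSm.const_mul _
  have hchange := setLIntegral_unitBox_univ_prod_eq_lintegral_map νA νK
    (fun z : (Fin n → (mixedSpace K)ˣ) × ↥(Kinf n K) => (k : ℝ≥0∞) * ∑ i, ∑ q, F i q z) hGm
  rw [← hμA, ← hμK] at hchange
  calc ∫⁻ p in unitBox (Set.univ : Set (HeightOneSpectrum (𝓞 K))) ×ˢ Set.univ,
        torusIntegrand n K
          (whittakerCoeff ν₀ (unipotentTateDomain n K) (adeleAddChar K)
            (invQuot (AdelicGroupData.gl n K) (smoothedForm η (f : (AdelicGroupData.gl n K).L2 μ))))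
          (standardTestFun n K (gaussArchTestFun n K)) 1 p ∂(νA.prod νK)
      ≤ ∫⁻ p in unitBox (Set.univ : Set (HeightOneSpectrum (𝓞 K))) ×ˢ Set.univ,
          (fun z : (Fin n → (mixedSpace K)ˣ) × ↥(Kinf n K) => (k : ℝ≥0∞) * ∑ i, ∑ q, F i q z)
            (archTorusOfIdele n K p.1, kinfOfMaximalCompact n K p.2) ∂(νA.prod νK) :=
        setLIntegral_mono' hboxm hpt
    _ = ∫⁻ z, (k : ℝ≥0∞) * ∑ i, ∑ q, F i q z ∂(μA.prod μK) := hchange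
    _ = (k : ℝ≥0∞) * ∑ i, ∑ q, ∫⁻ z, F i q z ∂(μA.prod μK) := by
        rw [lintegral_const_mul _ hSm,
          lintegral_finsetSum _ fun i _ => Finset.measurable_sum _ fun q _ => hFm i q]
        congr 1
        refine Finset.sum_congr rfl fun i _ => ?_
        exact lintegral_finsetSum _ fun q _ => hFm i q
    _ < ⊤ := ENNReal.mul_lt_top (ENNReal.natCast_lt_top k)
        (ENNReal.sum_lt_top.2 fun i _ => ENNReal.sum_lt_top.2 fun q _ => hFfin i q)

end Bridge

end Literature.NumberTheory.Automorphic
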